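import Mathlib
import Summits.ValiantsHypothesis.ValiantsHypothesis.Theorems.NewtonUnitEquationsTwoProductsMinkowskiSW

/-! # Brick `stub_sumsetChartCount` — crux `NewtonTauWeak` (stmt-ValiantsHypothesis-5904), line `binomial-normal-form`

CHART LEMMA FOR PLANAR MINKOWSKI SUMS (lead c7, THEOREM W♯, stub Q1a; pure planar geometry).  For a chart `σ : ℝ` and a
finite `S ⊆ ℕ²` let `U_σ(S) = {p ∈ S : ∃ t, ∀ q ∈ S, q ≠ p → t·q₀ + σ·q₁ < t·p₀ + σ·p₁}` be the set of points of `S` that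
are the UNIQUE maximiser over `S` of a height `h_t(q) = t·q₀ + σ·q₁` for some real `t`.  For `σ ≠ 0` and nonempty finite
`A, B ⊆ ℕ²` with sumset `A ⊕ B = (A ×ˢ B).image (·.1 + ·.2)`:  `|U_σ(A ⊕ B)| + 1 ≤ |U_σ(A)| + |U_σ(B)|`.

Proof.  (a) A unique `h_t`-maximiser `z` of `A ⊕ B` splits as `z = a + b` with `a`, `b` the unique `h_t`-maximisers of
`A`, `B` (`exists_split`: heights are additive and finsupp addition is cancellative).  (b) EXCHANGE: distinct unique `h_t`-,
`h_{t'}`-maximisers `p ≠ p'` of one set satisfy `(t − t')·(p₀ − p'₀) > 0` (`exchange`: add the two strict inequalities), so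
their abscissae differ (`apply_zero_ne`) and are ordered like `t` (`apply_zero_le`).  (c) Hence `z ↦ ((a_z)₀, (b_z)₀)` is
injective on `U_σ(A ⊕ B)` and its image is a chain, for the product order, inside `(·)₀ '' U_σ(A) × (·)₀ '' U_σ(B)`.
(d) A nonempty chain in a `p × q` grid has at most `p + q − 1` points (`TwoProducts.MinkowskiSW.card_chain_le`).  If
`U_σ(A ⊕ B) = ∅` the bound reads `1 ≤ |U_σ(A)| + |U_σ(B)|`, and `U_σ(A) ≠ ∅` because `σ ≠ 0` (`exists_chart`: the
maximiser of `h_K`, `K = |σ|·(max q₁ + 1)`, is unique).  The hypothesis `σ ≠ 0` is necessary: for `σ = 0` and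
`A = B = {(0,0), (0,1)}` all three sets are empty and the inequality fails. [folklore: vertices of planar Minkowski sums] -/

set_option linter.dupNamespace false -- single-conjunct summit: `ValiantsHypothesis.ValiantsHypothesis`

namespace Summit.ValiantsHypothesis.ValiantsHypothesis.Theorems.NewtonUnitEquationsNewtonTauWeak

open Summit.ValiantsHypothesis.ValiantsHypothesis.Theorems.TwoProducts.MinkowskiSW (card_chain_le)

namespace SumsetChartCountAux

/-- Membership in the sumset `(A ×ˢ B).image (·.1 + ·.2)`. [folklore] -/
theorem mem_sumset_iff {A B : Finset (Fin 2 →₀ ℕ)} {z : Fin 2 →₀ ℕ} :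
    z ∈ (A ×ˢ B).image (fun pq : (Fin 2 →₀ ℕ) × (Fin 2 →₀ ℕ) => pq.1 + pq.2) ↔ ∃ a ∈ A, ∃ b ∈ B, a + b = z := by
  simp only [Finset.mem_image, Finset.mem_product, Prod.exists]
  constructor
  · rintro ⟨a, b, ⟨ha, hb⟩, h⟩
    exact ⟨a, ha, b, hb, h⟩
  · rintro ⟨a, ha, b, hb, h⟩
    exact ⟨a, b, ⟨ha, hb⟩, h⟩

/-- Sums of members lie in the sumset. [folklore] -/
theorem add_mem_sumset {A B : Finset (Fin 2 →₀ ℕ)} {a b : Fin 2 →₀ ℕ} (ha : a ∈ A) (hb : b ∈ B) :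
    a + b ∈ (A ×ˢ B).image (fun pq : (Fin 2 →₀ ℕ) × (Fin 2 →₀ ℕ) => pq.1 + pq.2) :=
  mem_sumset_iff.mpr ⟨a, ha, b, hb, rfl⟩

/-- EXCHANGE INEQUALITY: if `p ≠ p'` are the unique maximisers over one set `S` of the heights `h_t`, `h_{t'}`
(`h_t(q) = t·q₀ + σ·q₁`), then `(t − t')·(p₀ − p'₀) > 0` — add the two strict inequalities. [folklore] -/
theorem exchange {S : Finset (Fin 2 →₀ ℕ)} {σ t t' : ℝ} {p p' : Fin 2 →₀ ℕ} (hp : p ∈ S) (hp' : p' ∈ S)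
    (hmax : ∀ q ∈ S, q ≠ p →
      t * ((q 0 : ℕ) : ℝ) + σ * ((q 1 : ℕ) : ℝ) < t * ((p 0 : ℕ) : ℝ) + σ * ((p 1 : ℕ) : ℝ))
    (hmax' : ∀ q ∈ S, q ≠ p' →
      t' * ((q 0 : ℕ) : ℝ) + σ * ((q 1 : ℕ) : ℝ) < t' * ((p' 0 : ℕ) : ℝ) + σ * ((p' 1 : ℕ) : ℝ))
    (hne : p ≠ p') : 0 < (t - t') * (((p 0 : ℕ) : ℝ) - ((p' 0 : ℕ) : ℝ)) := by
  have h1 := hmax p' hp' hne.symm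
  have h2 := hmax' p hp hne
  nlinarith [h1, h2]

/-- Distinct chart points of one set have distinct abscissae. [folklore] -/
theorem apply_zero_ne {S : Finset (Fin 2 →₀ ℕ)} {σ t t' : ℝ} {p p' : Fin 2 →₀ ℕ} (hp : p ∈ S) (hp' : p' ∈ S)
    (hmax : ∀ q ∈ S, q ≠ p →
      t * ((q 0 : ℕ) : ℝ) + σ * ((q 1 : ℕ) : ℝ) < t * ((p 0 : ℕ) : ℝ) + σ * ((p 1 : ℕ) : ℝ))
    (hmax' : ∀ q ∈ S, q ≠ p' →
      t' * ((q 0 : ℕ) : ℝ) + σ * ((q 1 : ℕ) : ℝ) < t' * ((p' 0 : ℕ) : ℝ) + σ * ((p' 1 : ℕ) : ℝ))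
    (hne : p ≠ p') : p 0 ≠ p' 0 := by
  intro h0
  have h := exchange hp hp' hmax hmax' hne
  have h0' : ((p 0 : ℕ) : ℝ) = ((p' 0 : ℕ) : ℝ) := by exact_mod_cast h0
  rw [h0', sub_self, mul_zero] at h
  exact lt_irrefl _ h

/-- Chart points move monotonically: the unique `h_t`-maximiser has abscissa at most that of the unique
`h_{t'}`-maximiser whenever `t ≤ t'`. [folklore] -/
theorem apply_zero_le {S : Finset (Fin 2 →₀ ℕ)} {σ t t' : ℝ} {p p' : Fin 2 →₀ ℕ} (hp : p ∈ S) (hp' : p' ∈ S)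
    (hmax : ∀ q ∈ S, q ≠ p →
      t * ((q 0 : ℕ) : ℝ) + σ * ((q 1 : ℕ) : ℝ) < t * ((p 0 : ℕ) : ℝ) + σ * ((p 1 : ℕ) : ℝ))
    (hmax' : ∀ q ∈ S, q ≠ p' →
      t' * ((q 0 : ℕ) : ℝ) + σ * ((q 1 : ℕ) : ℝ) < t' * ((p' 0 : ℕ) : ℝ) + σ * ((p' 1 : ℕ) : ℝ))
    (htt' : t ≤ t') : p 0 ≤ p' 0 := by
  by_cases hne : p = p'
  · rw [hne]
  have h := exchange hp hp' hmax hmax' hne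
  by_contra hlt
  have hlt' : ((p' 0 : ℕ) : ℝ) < ((p 0 : ℕ) : ℝ) := by exact_mod_cast not_le.mp hlt
  nlinarith [mul_nonneg (sub_nonneg.mpr htt') (sub_nonneg.mpr hlt'.le)]

/-- SPLITTING: a unique `h_t`-maximiser of `A ⊕ B` is `a + b` with `a`, `b` the unique `h_t`-maximisers of `A`, `B`.
[folklore] -/
theorem exists_split {σ t : ℝ} {A B : Finset (Fin 2 →₀ ℕ)} (hA : A.Nonempty) (hB : B.Nonempty) {z : Fin 2 →₀ ℕ}
    (hz : z ∈ (A ×ˢ B).image (fun pq : (Fin 2 →₀ ℕ) × (Fin 2 →₀ ℕ) => pq.1 + pq.2))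
    (hmax : ∀ q ∈ (A ×ˢ B).image (fun pq : (Fin 2 →₀ ℕ) × (Fin 2 →₀ ℕ) => pq.1 + pq.2), q ≠ z →
      t * ((q 0 : ℕ) : ℝ) + σ * ((q 1 : ℕ) : ℝ) < t * ((z 0 : ℕ) : ℝ) + σ * ((z 1 : ℕ) : ℝ)) :
    ∃ a ∈ A, ∃ b ∈ B, z = a + b ∧
      (∀ q ∈ A, q ≠ a → t * ((q 0 : ℕ) : ℝ) + σ * ((q 1 : ℕ) : ℝ) < t * ((a 0 : ℕ) : ℝ) + σ * ((a 1 : ℕ) : ℝ)) ∧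
      (∀ q ∈ B, q ≠ b → t * ((q 0 : ℕ) : ℝ) + σ * ((q 1 : ℕ) : ℝ) < t * ((b 0 : ℕ) : ℝ) + σ * ((b 1 : ℕ) : ℝ)) := by
  classical
  set f : (Fin 2 →₀ ℕ) → ℝ := fun x => t * ((x 0 : ℕ) : ℝ) + σ * ((x 1 : ℕ) : ℝ) with hf
  have hfadd : ∀ x y : Fin 2 →₀ ℕ, f (x + y) = f x + f y := by
    intro x y; simp only [hf, Finsupp.coe_add, Pi.add_apply, Nat.cast_add]; ring
  obtain ⟨a, ha, hale⟩ := Finset.exists_max_image A f hA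
  obtain ⟨b, hb, hble⟩ := Finset.exists_max_image B f hB
  have hab := add_mem_sumset ha hb
  -- every point of `A ⊕ B` has height at most `f a + f b`
  have hupp : ∀ q ∈ (A ×ˢ B).image (fun pq : (Fin 2 →₀ ℕ) × (Fin 2 →₀ ℕ) => pq.1 + pq.2), f q ≤ f a + f b := by
    intro q hq
    obtain ⟨x, hx, y, hy, rfl⟩ := mem_sumset_iff.mp hq
    rw [hfadd]; exact add_le_add (hale x hx) (hble y hy)
  -- hence `z = a + b`
  have hzab : z = a + b := by
    by_contra hne
    have h1 := hmax (a + b) hab (Ne.symm hne)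
    have h2 := hupp z hz
    change f (a + b) < f z at h1
    rw [hfadd] at h1
    linarith
  refine ⟨a, ha, b, hb, hzab, ?_, ?_⟩
  · intro x hx hxa
    refine lt_of_le_of_ne (hale x hx) fun heq => hxa ?_
    -- `x + b` has the maximal height, so equals `z = a + b`
    have hxb := add_mem_sumset hx hb
    by_contra hxne
    have hne : x + b ≠ z := by rw [hzab]; intro h; exact hxne (add_right_cancel h)
    have h1 := hmax (x + b) hxb hne
    change f (x + b) < f z at h1
    rw [hzab, hfadd, hfadd] at h1
    change f x = f a at heq
    linarith
  · intro y hy hyb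
    refine lt_of_le_of_ne (hble y hy) fun heq => hyb ?_
    have hay := add_mem_sumset ha hy
    by_contra hyne
    have hne : a + y ≠ z := by rw [hzab]; intro h; exact hyne (add_left_cancel h)
    have h1 := hmax (a + y) hay hne
    change f (a + y) < f z at h1
    rw [hzab, hfadd, hfadd] at h1
    change f y = f b at heq
    linarith

/-- EXISTENCE OF A CHART POINT (`σ ≠ 0`): a nonempty finite `S ⊆ ℕ²` has a point that is the unique maximiser of some
height `h_K`; take `K = |σ|·(max q₁ + 1)`, for which `h_K` is injective on `S`. [folklore] -/
theorem exists_chart {σ : ℝ} (hσ : σ ≠ 0) {S : Finset (Fin 2 →₀ ℕ)} (hS : S.Nonempty) :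
    ∃ p ∈ S, ∃ t : ℝ, ∀ q ∈ S, q ≠ p →
      t * ((q 0 : ℕ) : ℝ) + σ * ((q 1 : ℕ) : ℝ) < t * ((p 0 : ℕ) : ℝ) + σ * ((p 1 : ℕ) : ℝ) := by
  classical
  set M : ℕ := S.sup (fun q => q 1) with hM
  have hqM : ∀ q ∈ S, ((q 1 : ℕ) : ℝ) ≤ (M : ℝ) := fun q hq => by
    exact_mod_cast Finset.le_sup (f := fun q : Fin 2 →₀ ℕ => q 1) hq
  set K : ℝ := |σ| * ((M : ℝ) + 1) with hK
  set g : (Fin 2 →₀ ℕ) → ℝ := fun q => K * ((q 0 : ℕ) : ℝ) + σ * ((q 1 : ℕ) : ℝ) with hg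
  obtain ⟨p, hp, hle⟩ := Finset.exists_max_image S g hS
  refine ⟨p, hp, K, fun q hq hne => lt_of_le_of_ne (hle q hq) fun heq => hne ?_⟩
  have hσpos : 0 < |σ| := abs_pos.mpr hσ
  -- `g` strictly increases with the abscissa on `S`
  have hsep : ∀ x ∈ S, ∀ y ∈ S, x 0 < y 0 → g x < g y := by
    intro x hx y hy hxy
    have h1 : ((x 0 : ℕ) : ℝ) + 1 ≤ ((y 0 : ℕ) : ℝ) := by exact_mod_cast Nat.succ_le_of_lt hxy
    have hK0 : 0 ≤ K := by positivity
    have h2 : K * (((x 0 : ℕ) : ℝ) + 1) ≤ K * ((y 0 : ℕ) : ℝ) := mul_le_mul_of_nonneg_left h1 hK0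
    have h3 : σ * ((x 1 : ℕ) : ℝ) - σ * ((y 1 : ℕ) : ℝ) ≤ |σ| * (M : ℝ) := by
      have hx1 := hqM x hx
      have hy1 := hqM y hy
      have hx0 : (0 : ℝ) ≤ ((x 1 : ℕ) : ℝ) := by positivity
      have hy0 : (0 : ℝ) ≤ ((y 1 : ℕ) : ℝ) := by positivity
      calc σ * ((x 1 : ℕ) : ℝ) - σ * ((y 1 : ℕ) : ℝ) = σ * (((x 1 : ℕ) : ℝ) - ((y 1 : ℕ) : ℝ)) := by ring
        _ ≤ |σ * (((x 1 : ℕ) : ℝ) - ((y 1 : ℕ) : ℝ))| := le_abs_self _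
        _ = |σ| * |((x 1 : ℕ) : ℝ) - ((y 1 : ℕ) : ℝ)| := abs_mul _ _
        _ ≤ |σ| * (M : ℝ) :=
          mul_le_mul_of_nonneg_left (abs_sub_le_iff.mpr ⟨by linarith, by linarith⟩) hσpos.le
    have hKdef : K = |σ| * (M : ℝ) + |σ| := by rw [hK]; ring
    show K * ((x 0 : ℕ) : ℝ) + σ * ((x 1 : ℕ) : ℝ) < K * ((y 0 : ℕ) : ℝ) + σ * ((y 1 : ℕ) : ℝ)
    linarith
  have h0 : p 0 = q 0 := by
    by_contra h0
    rcases lt_or_gt_of_ne h0 with hlt | hlt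
    · exact (hsep p hp q hq hlt).ne' heq
    · exact (hsep q hq p hp hlt).ne heq
  have h1 : ((q 1 : ℕ) : ℝ) = ((p 1 : ℕ) : ℝ) := by
    have h0' : ((p 0 : ℕ) : ℝ) = ((q 0 : ℕ) : ℝ) := by exact_mod_cast h0
    change K * ((q 0 : ℕ) : ℝ) + σ * ((q 1 : ℕ) : ℝ) = K * ((p 0 : ℕ) : ℝ) + σ * ((p 1 : ℕ) : ℝ) at heq
    rw [h0'] at heq
    exact mul_left_cancel₀ hσ (by linarith)
  ext i
  fin_cases i
  · exact_mod_cast h0.symm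
  · exact_mod_cast h1

end SumsetChartCountAux

open SumsetChartCountAux

/-- **BRICK `stub_sumsetChartCount`** (registered signature of stub Q1a with the necessary hypothesis `σ ≠ 0` added):
the chart lemma for planar Minkowski sums, `|U_σ(A ⊕ B)| + 1 ≤ |U_σ(A)| + |U_σ(B)|` for nonempty finite `A, B ⊆ ℕ²` and a
chart `σ ≠ 0`. [folklore: vertices of planar Minkowski sums] -/
theorem stub_sumsetChartCount (σ : ℝ) (hσ : σ ≠ 0) (A B : Finset (Fin 2 →₀ ℕ)) (hA : A.Nonempty) (hB : B.Nonempty) :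
    {p : Fin 2 →₀ ℕ | p ∈ (A ×ˢ B).image (fun pq : (Fin 2 →₀ ℕ) × (Fin 2 →₀ ℕ) => pq.1 + pq.2) ∧
        ∃ t : ℝ, ∀ q ∈ (A ×ˢ B).image (fun pq : (Fin 2 →₀ ℕ) × (Fin 2 →₀ ℕ) => pq.1 + pq.2), q ≠ p →
          t * ((q 0 : ℕ) : ℝ) + σ * ((q 1 : ℕ) : ℝ) < t * ((p 0 : ℕ) : ℝ) + σ * ((p 1 : ℕ) : ℝ)}.ncard + 1 ≤
      {p : Fin 2 →₀ ℕ | p ∈ A ∧ ∃ t : ℝ, ∀ q ∈ A, q ≠ p →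
          t * ((q 0 : ℕ) : ℝ) + σ * ((q 1 : ℕ) : ℝ) < t * ((p 0 : ℕ) : ℝ) + σ * ((p 1 : ℕ) : ℝ)}.ncard +
      {p : Fin 2 →₀ ℕ | p ∈ B ∧ ∃ t : ℝ, ∀ q ∈ B, q ≠ p →
          t * ((q 0 : ℕ) : ℝ) + σ * ((q 1 : ℕ) : ℝ) < t * ((p 0 : ℕ) : ℝ) + σ * ((p 1 : ℕ) : ℝ)}.ncard := by
  classical
  set AB := (A ×ˢ B).image (fun pq : (Fin 2 →₀ ℕ) × (Fin 2 →₀ ℕ) => pq.1 + pq.2) with hAB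
  set SAB := {p : Fin 2 →₀ ℕ | p ∈ AB ∧ ∃ t : ℝ, ∀ q ∈ AB, q ≠ p →
      t * ((q 0 : ℕ) : ℝ) + σ * ((q 1 : ℕ) : ℝ) < t * ((p 0 : ℕ) : ℝ) + σ * ((p 1 : ℕ) : ℝ)} with hSAB
  set SA := {p : Fin 2 →₀ ℕ | p ∈ A ∧ ∃ t : ℝ, ∀ q ∈ A, q ≠ p →
      t * ((q 0 : ℕ) : ℝ) + σ * ((q 1 : ℕ) : ℝ) < t * ((p 0 : ℕ) : ℝ) + σ * ((p 1 : ℕ) : ℝ)} with hSA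
  set SB := {p : Fin 2 →₀ ℕ | p ∈ B ∧ ∃ t : ℝ, ∀ q ∈ B, q ≠ p →
      t * ((q 0 : ℕ) : ℝ) + σ * ((q 1 : ℕ) : ℝ) < t * ((p 0 : ℕ) : ℝ) + σ * ((p 1 : ℕ) : ℝ)} with hSB
  have hfinAB : SAB.Finite := (Finset.finite_toSet AB).subset (by rintro p ⟨hp, -⟩; exact hp)
  have hfinA : SA.Finite := (Finset.finite_toSet A).subset (by rintro p ⟨hp, -⟩; exact hp)
  have hfinB : SB.Finite := (Finset.finite_toSet B).subset (by rintro p ⟨hp, -⟩; exact hp)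
  -- (a) split every chart point of `A ⊕ B` at its exposing time
  have hsplit : ∀ z ∈ SAB, ∃ t : ℝ, ∃ a ∈ A, ∃ b ∈ B, z = a + b ∧
      (∀ q ∈ A, q ≠ a → t * ((q 0 : ℕ) : ℝ) + σ * ((q 1 : ℕ) : ℝ) < t * ((a 0 : ℕ) : ℝ) + σ * ((a 1 : ℕ) : ℝ)) ∧
      (∀ q ∈ B, q ≠ b → t * ((q 0 : ℕ) : ℝ) + σ * ((q 1 : ℕ) : ℝ) < t * ((b 0 : ℕ) : ℝ) + σ * ((b 1 : ℕ) : ℝ)) := by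
    rintro z ⟨hz, t, hmax⟩
    exact ⟨t, exists_split hA hB hz hmax⟩
  choose! T fa hfaA fb hfbB hzab hamax hbmax using hsplit
  have hfaSA : ∀ z ∈ SAB, fa z ∈ SA := fun z hz => ⟨hfaA z hz, T z, hamax z hz⟩
  have hfbSB : ∀ z ∈ SAB, fb z ∈ SB := fun z hz => ⟨hfbB z hz, T z, hbmax z hz⟩
  -- (c) the pair map `z ↦ ((a_z)₀, (b_z)₀)` is injective on `U_σ(A ⊕ B)` and its image is a chain
  set P : Finset ℕ := hfinA.toFinset.image (fun a => a 0) with hP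
  set Q : Finset ℕ := hfinB.toFinset.image (fun b => b 0) with hQ
  set Pr : Finset (ℕ × ℕ) := hfinAB.toFinset.image (fun z => ((fa z) 0, (fb z) 0)) with hPr
  have hinj : Set.InjOn (fun z => ((fa z) 0, (fb z) 0)) (hfinAB.toFinset : Set (Fin 2 →₀ ℕ)) := by
    intro z hz z' hz' hzz
    rw [Finset.mem_coe, Set.Finite.mem_toFinset] at hz hz'
    simp only [Prod.mk.injEq] at hzz
    have ha : fa z = fa z' := by
      by_contra hne
      exact apply_zero_ne (hfaA z hz) (hfaA z' hz') (hamax z hz) (hamax z' hz') hne hzz.1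
    have hb : fb z = fb z' := by
      by_contra hne
      exact apply_zero_ne (hfbB z hz) (hfbB z' hz') (hbmax z hz) (hbmax z' hz') hne hzz.2
    rw [hzab z hz, hzab z' hz', ha, hb]
  have hPrcard : Pr.card = hfinAB.toFinset.card := Finset.card_image_of_injOn hinj
  have hPrPQ : ∀ x ∈ Pr, x.1 ∈ P ∧ x.2 ∈ Q := by
    intro x hx
    obtain ⟨z, hz, rfl⟩ := Finset.mem_image.mp hx
    rw [Set.Finite.mem_toFinset] at hz
    exact ⟨Finset.mem_image.mpr ⟨fa z, (Set.Finite.mem_toFinset _).mpr (hfaSA z hz), rfl⟩,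
      Finset.mem_image.mpr ⟨fb z, (Set.Finite.mem_toFinset _).mpr (hfbSB z hz), rfl⟩⟩
  have hchain : ∀ x ∈ Pr, ∀ x' ∈ Pr, (x.1 ≤ x'.1 ∧ x.2 ≤ x'.2) ∨ (x'.1 ≤ x.1 ∧ x'.2 ≤ x.2) := by
    intro x hx x' hx'
    obtain ⟨z, hz, rfl⟩ := Finset.mem_image.mp hx
    obtain ⟨z', hz', rfl⟩ := Finset.mem_image.mp hx'
    rw [Set.Finite.mem_toFinset] at hz hz'
    rcases le_total (T z) (T z') with hle | hle
    · exact Or.inl ⟨apply_zero_le (hfaA z hz) (hfaA z' hz') (hamax z hz) (hamax z' hz') hle,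
        apply_zero_le (hfbB z hz) (hfbB z' hz') (hbmax z hz) (hbmax z' hz') hle⟩
    · exact Or.inr ⟨apply_zero_le (hfaA z' hz') (hfaA z hz) (hamax z' hz') (hamax z hz) hle,
        apply_zero_le (hfbB z' hz') (hfbB z hz) (hbmax z' hz') (hbmax z hz) hle⟩
  -- (d) count: `|Pr| + 1 ≤ |P| + |Q| ≤ |U_σ(A)| + |U_σ(B)|`
  have hPcard : P.card ≤ SA.ncard := by
    rw [Set.ncard_eq_toFinset_card _ hfinA, hP]
    exact Finset.card_image_le
  have hQcard : Q.card ≤ SB.ncard := by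
    rw [Set.ncard_eq_toFinset_card _ hfinB, hQ]
    exact Finset.card_image_le
  rw [Set.ncard_eq_toFinset_card _ hfinAB, ← hPrcard]
  by_cases hPrne : Pr.Nonempty
  · exact (card_chain_le P Q Pr hPrPQ hchain hPrne).trans (add_le_add hPcard hQcard)
  · rw [Finset.not_nonempty_iff_eq_empty.mp hPrne, Finset.card_empty]
    -- `U_σ(A)` is nonempty since `σ ≠ 0`
    have hApos : 0 < SA.ncard := by
      obtain ⟨a, ha, t, hmax⟩ := exists_chart hσ hA
      exact (Set.ncard_pos hfinA).mpr ⟨a, ha, t, hmax⟩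
    omega

end Summit.ValiantsHypothesis.ValiantsHypothesis.Theorems.NewtonUnitEquationsNewtonTauWeak
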